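import Literature.Probability.LatticeModels.VillainDisorderedModel
import Literature.Probability.LatticeModels.LatticePathChains
import Literature.Probability.LatticeModels.XYTorusFreeBoxComparison
import Literature.Probability.LatticeModels.CircleWeightBondModel
import HarnessLib

/-!
# The bond system of the space-time torus and the slice embedding of a lattice domain

The slice embedding (and elementary API) connecting the Villain CURRENT model on the space-time
torus `(ℤ/Lℤ)^d × ℤ/Mℤ` (`PositiveCurrentModel`, `VillainCurrentModel`: bonds
`JCurrent.Bond d L M`, `b = (s, μ) : s → s + e_μ`) with the Villain SPIN model with bond phases of
`VillainDisorderedModel` (any `BondSystem`) and with Garban–Spencer's lattice path ensembles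
(`latticeBonds Λ`, `Λ ⊂ ℤ^d`):

* (`JCurrent.bondSystem d L M`, the bond system `src (s,μ) = s`, `tgt (s,μ) = s + e_μ` of the torus, is
  the tree's, `CircleWeightBondModel.lean`; here only its `simp` API);
* `sliceEmbedding M hinj : (latticeBonds Λ).Embedding (JCurrent.bondSystem d L M)` for every finite
  `Λ ⊂ ℤ^d` on which reduction mod `L` is injective (`hinj`; e.g. `Λ = box d n` with `2n < L`,
  `torusProj_injOn_box_of_lt`): `v ↦ (π v, 0)` into the time-zero slice, the bond `{u, u+eᵢ}` ↦ the
  torus bond `((π u, 0), eᵢ)` with the orientation sign dictated by `latticeBonds`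
  (`edgeData` extracts the directed pair `(u, i)` of a bond, `edgesIn_eq_image_directed`).

Used to push the ball-path ensembles of `ℤ³` into the torus for the long-range order of the
Villain current model (`villain_longRangeOrder`,
`Summit.AtomisticToContinuum.BoseEinsteinCondensation.Theses.BECStoquasticCensoring.HomogeneousVillainLRO`).

## References

* M. Wallin, E. Sørensen, S. Girvin, A. P. Young, Phys. Rev. B 49 (1994) 12115, §II (bonds of the
  space-time torus). [WallinEtAl1994]
* C. Garban, T. Spencer, J. Math. Phys. 63 (2022) 093302, §1.2.1 (free-boundary bond systems of
  `Λ ⊂ ℤ^d`). [GarbanSpencer2022]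
-/

noncomputable section

namespace Literature.Probability.LatticeModels

open MeasureTheory Finset TopologicalSpace Filter
open scoped BigOperators ComplexConjugate Topology
open Literature.MathematicalPhysics.QuantumFieldTheory

/-! ### The bond system of the space-time torus (`JCurrent.bondSystem`, `CircleWeightBondModel`) -/

namespace JCurrent

variable (d L M : ℕ)

/-- The source of the bond `(s, μ)` of the space-time torus is `s`. [folklore] -/
@[simp] theorem bondSystem_src (b : Bond d L M) : (bondSystem d L M).src b = b.1 := rfl

/-- The target of the bond `(s, μ)` of the space-time torus is `s + e_μ`. [folklore] -/
@[simp] theorem bondSystem_tgt (b : Bond d L M) : (bondSystem d L M).tgt b = b.1 + unitVec b.2 := rfl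

variable {d L M}

/-- A spatial unit step in the time-zero slice: `(π u, 0) + e_{some i} = (π(u + eᵢ), 0)`. [folklore] -/
theorem proj_zero_add_unitVec_some (u : Site d) (i : Fin d) :
    ((Torus.proj L u, (0 : ZMod M)) : SpaceTimeSite d L M) + unitVec (some i) =
      (Torus.proj L (u + Pi.single i 1), 0) := by
  rw [torusProj_add_single_one]
  exact Prod.ext (by simp [unitVec]) (by simp [unitVec])

end JCurrent

/-! ### Lattice domains inside a coordinate slice of the torus -/

section SliceEmbedding

variable {d : ℕ} (Λ : Finset (Site d))

/-- Every bond of `latticeBonds Λ` is `{u, u + eᵢ}` for a unique directed pair `(u, i)` with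
`u, u + eᵢ ∈ Λ`. [folklore] -/
theorem exists_edgeData (a : ↥(edgesIn (zdGraph d) Λ)) :
    ∃ p : Site d × Fin d, p.1 ∈ Λ ∧ p.1 + Pi.single p.2 1 ∈ Λ ∧
      (a : Sym2 (Site d)) = s(p.1, p.1 + Pi.single p.2 1) := by
  have h : (a : Sym2 (Site d)) ∈ ((Λ ×ˢ Finset.univ).filter
      (fun p : Site d × Fin d => p.1 + Pi.single p.2 1 ∈ Λ)).image
        (fun p => s(p.1, p.1 + Pi.single p.2 1)) := by
    rw [← edgesIn_eq_image_directed]; exact a.2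
  rw [Finset.mem_image] at h
  obtain ⟨p, hp, hpa⟩ := h
  rw [Finset.mem_filter, Finset.mem_product] at hp
  exact ⟨p, hp.1.1, hp.2, hpa.symm⟩

/-- The directed pair `(u, i)` of a bond `{u, u + eᵢ}` of `Λ`. [folklore] -/
def edgeData (a : ↥(edgesIn (zdGraph d) Λ)) : Site d × Fin d :=
  Classical.choose (exists_edgeData Λ a)

/-- The defining properties of `edgeData`. [folklore] -/
theorem edgeData_spec (a : ↥(edgesIn (zdGraph d) Λ)) :
    (edgeData Λ a).1 ∈ Λ ∧ (edgeData Λ a).1 + Pi.single (edgeData Λ a).2 1 ∈ Λ ∧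
      (a : Sym2 (Site d)) = s((edgeData Λ a).1, (edgeData Λ a).1 + Pi.single (edgeData Λ a).2 1) :=
  Classical.choose_spec (exists_edgeData Λ a)

/-- Source and target of a bond of `Λ` are its directed pair, in one of the two orders. [folklore] -/
theorem src_tgt_eq_edgeData (a : ↥(edgesIn (zdGraph d) Λ)) :
    (((latticeBonds Λ).src a : Site d) = (edgeData Λ a).1 ∧
        ((latticeBonds Λ).tgt a : Site d) = (edgeData Λ a).1 + Pi.single (edgeData Λ a).2 1) ∨
      (((latticeBonds Λ).src a : Site d) = (edgeData Λ a).1 + Pi.single (edgeData Λ a).2 1 ∧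
        ((latticeBonds Λ).tgt a : Site d) = (edgeData Λ a).1) := by
  have h := mk_src_tgt Λ a
  rw [(edgeData_spec Λ a).2.2, Sym2.eq_iff] at h
  exact h

variable {Λ} {L : ℕ} (M : ℕ) (hinj : Set.InjOn (Torus.proj (d := d) L) Λ)

/-- **The embedding of the free-boundary bond system of `Λ ⊂ ℤ^d` into the time-zero slice of the
space-time torus `(ℤ/Lℤ)^d × ℤ/Mℤ`**, for any `Λ` on which reduction mod `L` is injective (e.g. a
cube of side `< L`): vertices `v ↦ (π v, 0)`, the bond `{u, u + eᵢ}` ↦ the torus bond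
`((π u, 0), eᵢ)`, with orientation sign `+1` if `latticeBonds` orients it as `u → u + eᵢ` and `-1`
otherwise. [folklore] -/
def sliceEmbedding : (latticeBonds Λ).Embedding (JCurrent.bondSystem d L M) where
  vmap v := (Torus.proj L (v : Site d), 0)
  emap a := ((Torus.proj L (edgeData Λ a).1, 0), some (edgeData Λ a).2)
  sign a := if ((latticeBonds Λ).src a : Site d) = (edgeData Λ a).1 then 1 else -1
  emap_injective a b hab := by
    simp only [Prod.mk.injEq, Option.some.injEq] at hab
    obtain ⟨⟨hu, -⟩, hi⟩ := hab
    have hu' : (edgeData Λ a).1 = (edgeData Λ b).1 :=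
      hinj (edgeData_spec Λ a).1 (edgeData_spec Λ b).1 hu
    apply Subtype.ext
    rw [(edgeData_spec Λ a).2.2, (edgeData_spec Λ b).2.2, hu', hi]
  sign_eq a := by
    by_cases h : ((latticeBonds Λ).src a : Site d) = (edgeData Λ a).1
    · exact Or.inl (if_pos h)
    · exact Or.inr (if_neg h)
  bondChar_emap a θ' := by
    rcases src_tgt_eq_edgeData Λ a with ⟨hs, ht⟩ | ⟨hs, ht⟩
    · rw [if_pos hs, zpow_one]
      simp only [BondSystem.bondChar, diffChar_apply, JCurrent.bondSystem_src, JCurrent.bondSystem_tgt,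
        Function.comp_apply, JCurrent.proj_zero_add_unitVec_some, hs, ht]
    · have hne : ((latticeBonds Λ).src a : Site d) ≠ (edgeData Λ a).1 := by
        rw [hs]
        intro h
        have h1 := congrFun h (edgeData Λ a).2
        simp only [Pi.add_apply, Pi.single_eq_same] at h1
        omega
      rw [if_neg hne, zpow_neg_one, ← Circle.coe_inv]
      congr 1
      simp only [BondSystem.bondChar, diffChar_apply, JCurrent.bondSystem_src, JCurrent.bondSystem_tgt,
        Function.comp_apply, JCurrent.proj_zero_add_unitVec_some, hs, ht, mul_inv_rev, inv_inv]

/-- The vertex map of the slice embedding. [folklore] -/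
@[simp] theorem sliceEmbedding_vmap (v : ↥Λ) :
    (sliceEmbedding M hinj).vmap v = ((Torus.proj L (v : Site d), 0) : JCurrent.SpaceTimeSite d L M) := rfl

end SliceEmbedding

end Literature.Probability.LatticeModels
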